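import Summits.BirchSwinnertonDyer.BirchSwinnertonDyer.Theses.CongruentShaFreeCut
import Literature.NumberTheory.EllipticCurves.Monsky1990.MockHeegnerCongruentNumbers

/-! # Route `CongruentShaFreeCut` (rung S2) — crux `RankPosOfTwoSelmerCorankOne`
(stmt-BirchSwinnertonDyer-19079, the route's declared RESIDUAL conjunct): its FIRST RUNG — the BC5
separating witness on the Monsky-uncovered family `W`

The crux is the Ш-freeness half of the rank-one `2`-converse for the congruent number curves
`E_n : y² = x³ − n²x` at the RAMIFIED CM prime `2`:
`∀ n ≠ 0, corank_{ℤ₂} Sel_{2^∞}(E_n/ℚ) = 1 ⟹ rank E_n(ℚ) ≥ 1`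
(`Summit.BirchSwinnertonDyer.BirchSwinnertonDyer.Theses.CongruentShaFreeCut.RankPosOfTwoSelmerCorankOne`).

THE RUNG. Monsky, *Mock Heegner points and congruent numbers*, Math. Z. 204 (1990), Cor. 5.15 with
Remark (2) — tree fact `Monsky1990.cor515_rank_eq_one_and_card_selmerGroup_two` (refereed; mock
Heegner points over `ℚ(i√(NN*))`, `2` RAMIFIED, no `L`-value anywhere) — gives `rank E_N(ℚ) = 1`
and `#Sel^{(2)}(E_N) = 8` on twelve prime / two-prime families, hence (tree theorems of the same
file) `corank_{ℤ₂} Sel_{2^∞}(E_N) = 1` and `Ш(E_N)[2^∞] = 0`: a crux-A instance, proved from print,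
AT THE CRUX'S OWN PRIME `2`. The cell's referee ledger GAP-LEDGER-read2-monsky-g29 (§B, frozen sha256
1eab0906…; adopted VERDICT Part IX-D §4) located the sub-family on which the rung is SEPARATING, i.e.
on which the leaf's conclusion `ord_{s=1} L(E_N, s) = 1` is NOT in print (Tian 2014 Thm 1.3 and
Li–Liu–Tian 2024 structurally exclude it; Tian–Yuan–Zhang 2017 Thm 1.2's class-6 criterion is
provably silent there, `Σ₂′` even; citation-graph / corpus / galaxy sweep null):
  `W := {N = 2pq : p, q prime, p ≡ 3, q ≡ 5 (mod 8), (p/q) = −1} ∪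
        {N = 2pq : p ≡ 5, q ≡ 7 (mod 8), (p/q) = −1}`   (`N ≡ 6 (mod 8)`, root number `−1`),
the `(p/q) = −1` halves of Monsky's group-(2) class-6 families `2p₃p₅`, `2p₅p₇` (his group (2)
carries NO symbol condition, so the fact covers both halves). Examples: `30 = 2·3·5` (the `5-12-13`
triangle), `70 = 2·5·7`, `174`, `230`.

WHAT IS PROVED HERE (modulo the ONE refereed named fact `hM`; no new definition, no new fact):
* `rung_monskyUncovered` — crux A's statement VERBATIM restricted to `n = 2pq ∈ W` (explicit
  binders `p q`, the residue classes, the symbol, then the crux's own hypothesis and conclusion).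
  HONESTY: the symbol hypothesis and the corank hypothesis are NOT USED by the proof (rank `≥ 1`
  holds on all of Monsky's group (2), and the corank hypothesis HOLDS on `W`,
  `selmerCorank_two_eq_one_monskyUncovered`, so the rung is non-vacuous); the symbol is what
  restricts the statement to the halves where the LEAF's conclusion is not in print — the
  separation is at family level (∀-quantified), exactly what BC5 quantifies over (ledger §B.4
  caveats (i)–(iii)).
* `rank_eq_one_and_sha_two_eq_bot_monskyUncovered` — the full Monsky package on `W`
  (`rank = 1 ∧ Ш[2^∞] = 0`), `mod_eight_monskyUncovered` (`N ≡ 6 (mod 8)`), and the two displayed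
  members `30`, `70`.
* `rankPos_of_cor515` — crux A on ALL twelve Cor 5.15 families; NOT a separating witness (the leaf's
  conclusion is in print on 10/12 halves, ledger §B.4) and recorded only as the literal restriction
  of the crux to Monsky's families; the WITNESS is `rung_monskyUncovered`.
The named forms for the tribunal's `--witness` / `--s-case` identifiers (`IsMonskyUncoveredFamily`,
`RankPosOnMonskyUncovered`, `AnalyticRankOneOnMonskyUncovered` — read2 g29 §D.1/§E shapes) are filed
separately in `Theorems/CongruentShaFreeCutDefs.lean` (definitions are reviewed; this proof file is
definition-free so that it lands on the kernel). This file SUPPORTS and does not close the item; the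
crux stays the route's declared residual (Kříž 2020 v5 Thm 10.13 / Fan–Wan v2 Thm 1.1, unrefereed).
-/

namespace Summit.BirchSwinnertonDyer.BirchSwinnertonDyer.Theorems.CongruentShaFreeCutRungMonsky

open Literature.NumberTheory.EllipticCurves Literature.NumberTheory.EllipticCurves.Monsky1990
open WeierstrassCurve

/-- **`W ⊂` Monsky's Cor. 5.15 families** (group (2), the `2p₅p₃` / `2p₅p₇` disjunct of
`Monsky1990.IsCor515Family`): for primes `p ≡ 3, q ≡ 5 (mod 8)` or `p ≡ 5, q ≡ 7 (mod 8)`,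
`2pq` is in the families (no symbol condition is needed for membership). -/
theorem isCor515Family_two_mul_mul {p q : ℕ} (hp : p.Prime) (hq : q.Prime)
    (h8 : p % 8 = 3 ∧ q % 8 = 5 ∨ p % 8 = 5 ∧ q % 8 = 7) : IsCor515Family (2 * (p * q)) := by
  rcases h8 with ⟨hp8, hq8⟩ | ⟨hp8, hq8⟩
  · exact Or.inr (Or.inr (Or.inr (Or.inl ⟨q, p, hq, hp, hq8, Or.inl hp8, by rw [Nat.mul_comm p q]⟩)))
  · exact Or.inr (Or.inr (Or.inr (Or.inl ⟨p, q, hp, hq, hp8, Or.inr hq8, rfl⟩)))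

/-- **Members of `W` are `≡ 6 (mod 8)`** (so the root number of `E_N` is `−1` and `ord_{s=1} L(E_N, s)`
is odd — the parity that is free; what print lacks on `W` is `L′(E_N, 1) ≠ 0`). -/
theorem mod_eight_monskyUncovered {p q : ℕ} (h8 : p % 8 = 3 ∧ q % 8 = 5 ∨ p % 8 = 5 ∧ q % 8 = 7) :
    2 * (p * q) % 8 = 6 := by
  rw [Nat.mul_mod, Nat.mul_mod p q]
  rcases h8 with ⟨hp8, hq8⟩ | ⟨hp8, hq8⟩ <;> simp [hp8, hq8]

/-- **The Monsky package on `W`** (modulo the refereed fact `hM` = Monsky 1990 Cor. 5.15 + Remark (2)):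
for `N = 2pq ∈ W`, `rank E_N(ℚ) = 1` and `Ш(E_N/ℚ)[2^∞] = 0` — purely descent-theoretic / mock-Heegner,
no `L`-value. -/
theorem rank_eq_one_and_sha_two_eq_bot_monskyUncovered
    (hM : cor515_rank_eq_one_and_card_selmerGroup_two) {p q : ℕ} (hp : p.Prime) (hq : q.Prime)
    (h8 : p % 8 = 3 ∧ q % 8 = 5 ∨ p % 8 = 5 ∧ q % 8 = 7) :
    (congruentNumberCurve (2 * (p * q))).mordellWeilRank = 1 ∧
      haveI := isElliptic_congruentNumberCurve (isCor515Family_two_mul_mul hp hq h8).ne_zero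
      AddCommGroup.primaryComponent (congruentNumberCurve (2 * (p * q))).sha 2 = ⊥ := by
  have hF := isCor515Family_two_mul_mul hp hq h8
  haveI := isElliptic_congruentNumberCurve hF.ne_zero
  exact ⟨(hM _ hF).1, primaryComponent_sha_two_eq_bot_of_cor515 hM hF⟩

/-- **Non-vacuity of the rung**: on `W` the crux's HYPOTHESIS holds — `corank_{ℤ₂} Sel_{2^∞}(E_N/ℚ) = 1`
for `N = 2pq ∈ W` (Greenberg's corank identity with rank `1` and `Ш[2^∞] = 0`; tree theorem
`Monsky1990.selmerCorank_two_eq_one_of_cor515`), modulo `hM`. -/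
theorem selmerCorank_two_eq_one_monskyUncovered
    (hM : cor515_rank_eq_one_and_card_selmerGroup_two) {p q : ℕ} (hp : p.Prime) (hq : q.Prime)
    (h8 : p % 8 = 3 ∧ q % 8 = 5 ∨ p % 8 = 5 ∧ q % 8 = 7) :
    (congruentNumberCurve (2 * (p * q))).selmerCorank 2 = 1 :=
  selmerCorank_two_eq_one_of_cor515 hM (isCor515Family_two_mul_mul hp hq h8)

/-- **RUNG (BC5 separating witness) for crux `RankPosOfTwoSelmerCorankOne`** — the crux restricted to
the Monsky-uncovered family `W`: for primes `p, q` with `p ≡ 3, q ≡ 5 (mod 8)` or `p ≡ 5, q ≡ 7 (mod 8)`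
and `(p/q) = −1`, if `corank_{ℤ₂} Sel_{2^∞}(E_{2pq}/ℚ) = 1` then `rank E_{2pq}(ℚ) ≥ 1` — PROVED at the
crux's own prime `2` from the refereed fact `hM` (Monsky 1990, Cor. 5.15 with Remark (2)), on a family
where the rung-leaf's conclusion `ord_{s=1} L(E_{2pq}, s) = 1` is not in print (cell ledger
GAP-LEDGER-read2-monsky-g29 §B; VERDICT IX-D §4). The symbol and corank hypotheses restrict the
statement; the proof does not consume them (see the module docstring). -/
theorem rung_monskyUncovered (hM : cor515_rank_eq_one_and_card_selmerGroup_two) :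
    ∀ ⦃p q : ℕ⦄, p.Prime → q.Prime → (p % 8 = 3 ∧ q % 8 = 5 ∨ p % 8 = 5 ∧ q % 8 = 7) →
      jacobiSym p q = -1 →
        (congruentNumberCurve (2 * (p * q))).selmerCorank 2 = 1 →
          1 ≤ (congruentNumberCurve (2 * (p * q))).mordellWeilRank :=
  fun _ _ hp hq h8 _ _ => (rank_eq_one_and_sha_two_eq_bot_monskyUncovered hM hp hq h8).1.ge

/-- **Crux A on ALL of Monsky's Cor. 5.15 families** (modulo `hM`): the literal restriction of
`RankPosOfTwoSelmerCorankOne` to `IsCor515Family`. NOT a separating witness — on 10 of the 12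
families/halves the leaf's conclusion `ord_{s=1} L = 1` is in print (Tian 2014, Tian–Yuan–Zhang 2017,
Li–Liu–Tian 2024; ledger §B.4) — recorded for completeness only. -/
theorem rankPos_of_cor515 (hM : cor515_rank_eq_one_and_card_selmerGroup_two) {N : ℕ}
    (hN : IsCor515Family N) (_hc : (congruentNumberCurve N).selmerCorank 2 = 1) :
    1 ≤ (congruentNumberCurve N).mordellWeilRank := by
  haveI := isElliptic_congruentNumberCurve hN.ne_zero
  exact (hM N hN).1.ge

/-- **`30 = 2·3·5 ∈ W`** (`3 ≡ 3`, `5 ≡ 5 (mod 8)`, `(3/5) = −1`; the `5-12-13` triangle has area `30`):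
the rung's instance — `corank_{ℤ₂} Sel_{2^∞}(E_{30}) = 1 ⟹ rank E_{30}(ℚ) ≥ 1`, modulo `hM`. -/
theorem rung_thirty (hM : cor515_rank_eq_one_and_card_selmerGroup_two)
    (hc : (congruentNumberCurve (2 * (3 * 5))).selmerCorank 2 = 1) :
    1 ≤ (congruentNumberCurve (2 * (3 * 5))).mordellWeilRank :=
  rung_monskyUncovered hM Nat.prime_three Nat.prime_five (Or.inl ⟨rfl, rfl⟩)
    (by norm_num [jacobiSym]) hc

/-- **`70 = 2·5·7 ∈ W`** (`5 ≡ 5`, `7 ≡ 7 (mod 8)`, `(5/7) = −1`): the rung's instance at `N = 70`,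
modulo `hM`. -/
theorem rung_seventy (hM : cor515_rank_eq_one_and_card_selmerGroup_two)
    (hc : (congruentNumberCurve (2 * (5 * 7))).selmerCorank 2 = 1) :
    1 ≤ (congruentNumberCurve (2 * (5 * 7))).mordellWeilRank :=
  rung_monskyUncovered hM Nat.prime_five (by norm_num) (Or.inr ⟨rfl, rfl⟩)
    (by norm_num [jacobiSym]) hc

end Summit.BirchSwinnertonDyer.BirchSwinnertonDyer.Theorems.CongruentShaFreeCutRungMonsky
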